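import Summits.ValiantsHypothesis.ValiantsHypothesis.Theorems.SymPencilEquivariantSdcNotQPPermRetractLinear
import Summits.ValiantsHypothesis.ValiantsHypothesis.Theorems.SymPencilEquivariantSdcNotQPPermRetractFrobenius
import Summits.ValiantsHypothesis.ValiantsHypothesis.Theorems.SymPencilEquivariantSdcNotQPPermEmbeddingBridge
import HarnessLib

/-!
# ValiantsHypothesis / SymPencil — crux `EquivariantSdcNotQP` (stmt-ValiantsHypothesis-17792), line
# `birth_EquivariantSdcNotQP`, open piece (iii″) of `stub_permify`: REDUCTION TO IRREDUCIBLE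
# REPRESENTATIONS (Maschke induction)

The open piece of `stub_permify` after tonight is (iii′) `PermEmbeddingQP` ⇐ (iii″) (abstract
finite-group form, `…PermEmbeddingBridge.lean`).  This file (helper of the item,
`--supports stmt-ValiantsHypothesis-17792 --as helper`; 0 definitions / 0 named facts) reduces (iii″)
to its IRREDUCIBLE case:
* `permEmbedding_of_irreducible` — **(iii″) ⇐ (D)**, where (D) says: every IRREDUCIBLE
  `ρ : G →* GL_k(ℂ)` (`G` finite, `φ : G ↠ 𝔖_n × 𝔖_n`, `ρ` scalar with `M`-th roots of unity on
  `ker φ`, `k ≤ M`) is an equivariant retract of a permutation representation of size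
  `≤ 2^{(log₂ M + log₂ n + d)^d}`.  Proof: Maschke induction on the dimension at the linear level
  (`exists_invariant_compl`, `linRetract_sum`, `linRetract_reindex`, `linRetract_of_equiv` from
  `…PermRetractLinear.lean`), the irreducible summands handled by (D) through a basis
  (`LinearMap.toMatrixAlgEquiv`, `LinearMap.toMatrix_mulVec_repr`), the `≤ m₀` summands absorbed by
  `mul_budget_le` (exponent `d ↦ d + 2`);
* `permEmbeddingQP_of_irreducible` — hence **(iii′) ⇐ (D)** (`permEmbeddingQP_of_abstract`).
With val-width-17792-p1's regular retraction (`…PermEmbeddingRegular.lean`, the large-dimension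
case) and the Frobenius retract (`…PermRetractFrobenius.lean`, the mechanism of Young's rule), the
honest residue of `stub_permify` is now the statement about IRREDUCIBLE representations of the finite
central extensions of `𝔖_n × 𝔖_n`: small irreducibles have a nonzero functional invariant under a
subgroup of index `2^{O((log dim + log n)^2)}` (Young's rule + Specht/spin degree bounds) — pure
representation theory of the symmetric groups, not in Mathlib.

Honest framing: (D), (iii′), `stub_permify`, the crux `SymPencil.EquivariantSdcNotQP` and `VP ≠ VNP`
remain OPEN; nothing here is progress on them.
-/

noncomputable section

set_option linter.dupNamespace false

namespace Summit.ValiantsHypothesis.ValiantsHypothesis.Theorems.SymPencilEquivariantSdcNotQP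

open Module Submodule

/-- Budget bookkeeping: a factor `m₀ < 2^{L+1}` is absorbed by raising the qp exponent by two.
[folklore] -/
theorem mul_budget_le (m₀ L A d : ℕ) (hm : m₀ < 2 ^ (L + 1)) :
    m₀ * 2 ^ ((L + A + d) ^ d) ≤ 2 ^ ((L + A + (d + 2)) ^ (d + 2)) := by
  have h1 : m₀ * 2 ^ ((L + A + d) ^ d) ≤ 2 ^ (L + 1) * 2 ^ ((L + A + d) ^ d) :=
    Nat.mul_le_mul_right _ hm.le
  rw [← pow_add] at h1
  refine h1.trans (Nat.pow_le_pow_right (by norm_num) ?_)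
  set B := (L + A + d) ^ d with hB
  have hB1 : 1 ≤ B := by
    rcases Nat.eq_zero_or_pos d with h | h
    · simp [hB, h]
    · exact Nat.one_le_pow _ _ (by omega)
  have h3 : B ≤ (L + A + d + 2) ^ d := Nat.pow_le_pow_left (by omega) d
  have h4 : L + 2 ≤ (L + A + d + 2) ^ 2 := by
    calc L + 2 ≤ L + A + d + 2 := by omega
      _ ≤ (L + A + d + 2) ^ 2 := by
          rw [sq]; exact Nat.le_mul_of_pos_left _ (by omega)
  calc L + 1 + B ≤ B * (L + 2) := by nlinarith
    _ ≤ B * (L + A + d + 2) ^ 2 := Nat.mul_le_mul_left _ h4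
    _ ≤ (L + A + d + 2) ^ d * (L + A + d + 2) ^ 2 := Nat.mul_le_mul_right _ h3
    _ = (L + A + (d + 2)) ^ (d + 2) := by ring

/-- **(iii″) from the irreducible case.**  Suppose (D): every IRREDUCIBLE representation
`ρ : G →* GL_k(ℂ)` of a finite group `G` with a surjection `φ : G ↠ 𝔖_n × 𝔖_n`, on whose kernel
`ρ` is scalar with `M`-th roots of unity, `k ≤ M`, is an equivariant retract of a permutation
representation of size `≤ 2^{(log₂ M + log₂ n + d)^d}`.  Then (iii″) (hypothesis `h` of
`permEmbeddingQP_of_abstract`, verbatim) holds with exponent `d + 2`: split `ℂ^{m₀}` into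
irreducibles (`exists_invariant_compl`, induction on the dimension), embed each by (D)
(transported through a basis), add the retracts (`linRetract_sum`, `linRetract_reindex`), and absorb
the number `≤ m₀` of summands into the exponent (`mul_budget_le`). [folklore] -/
theorem permEmbedding_of_irreducible
    (hD : ∃ d : ℕ, ∀ (n M k : ℕ) (G : Type) [Group G] [Finite G]
      (φ : G →* Equiv.Perm (Fin n) × Equiv.Perm (Fin n)) (ρ : G →* GL (Fin k) ℂ),
      Function.Surjective φ →
      (∀ g : G, φ g = 1 → ∃ c : ℂ, c ^ M = 1 ∧
        (ρ g : Matrix (Fin k) (Fin k) ℂ) = c • (1 : Matrix (Fin k) (Fin k) ℂ)) →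
      k ≤ M →
      (∀ W : Submodule ℂ (Fin k → ℂ),
        (∀ g : G, W ≤ W.comap (Matrix.toLin' (ρ g : Matrix (Fin k) (Fin k) ℂ))) → W = ⊥ ∨ W = ⊤) →
      ∃ m' ≤ 2 ^ ((Nat.log 2 M + Nat.log 2 n + d) ^ d),
        ∃ (ι : Matrix (Fin m') (Fin k) ℂ) (p : Matrix (Fin k) (Fin m') ℂ) (τ : G → Equiv.Perm (Fin m')),
          p * ι = 1 ∧ ∀ g : G,
            (τ g).permMatrix ℂ * ι = ι * (ρ g : Matrix (Fin k) (Fin k) ℂ) ∧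
            p * (τ g).permMatrix ℂ = (ρ g : Matrix (Fin k) (Fin k) ℂ) * p) :
    ∃ d : ℕ, ∀ (n m₀ : ℕ) (G : Type) [Group G] [Finite G]
      (φ : G →* Equiv.Perm (Fin n) × Equiv.Perm (Fin n)) (ρ : G →* GL (Fin m₀) ℂ),
      Function.Surjective φ →
      (∀ g : G, φ g = 1 → ∃ c : ℂ, (ρ g : Matrix (Fin m₀) (Fin m₀) ℂ) = c • (1 : Matrix (Fin m₀) (Fin m₀) ℂ)) →
      (∀ g : G, Matrix.det (ρ g : Matrix (Fin m₀) (Fin m₀) ℂ) = 1) →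
      ∃ m' ≤ 2 ^ ((Nat.log 2 m₀ + Nat.log 2 n + d) ^ d),
        ∃ (ι : Matrix (Fin m') (Fin m₀) ℂ) (p : Matrix (Fin m₀) (Fin m') ℂ) (τ : G → Equiv.Perm (Fin m')),
          p * ι = 1 ∧ ∀ g : G,
            (τ g).permMatrix ℂ * ι = ι * (ρ g : Matrix (Fin m₀) (Fin m₀) ℂ) ∧
            p * (τ g).permMatrix ℂ = (ρ g : Matrix (Fin m₀) (Fin m₀) ℂ) * p := by
  classical
  obtain ⟨d, hd⟩ := hD
  refine ⟨d + 2, fun n m₀ G _ _ φ ρ hφ hker hdet => ?_⟩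
  set Bd : ℕ := 2 ^ ((Nat.log 2 m₀ + Nat.log 2 n + d) ^ d) with hBd
  -- on the kernel: scalars with `c ^ m₀ = 1`
  have hkerM : ∀ g : G, φ g = 1 → ∃ c : ℂ, c ^ m₀ = 1 ∧
      (ρ g : Matrix (Fin m₀) (Fin m₀) ℂ) = c • (1 : Matrix (Fin m₀) (Fin m₀) ℂ) := by
    intro g hg
    obtain ⟨c, hc⟩ := hker g hg
    refine ⟨c, ?_, hc⟩
    have := hdet g
    rwa [hc, Matrix.det_smul, Matrix.det_one, mul_one, Fintype.card_fin] at this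
  -- Maschke induction on the dimension, at the linear level
  have key : ∀ (r : ℕ) (V : Type) [AddCommGroup V] [Module ℂ V] [FiniteDimensional ℂ V]
      (T : G →* (V →ₗ[ℂ] V)), Module.finrank ℂ V ≤ r → Module.finrank ℂ V ≤ m₀ →
      (∀ g : G, φ g = 1 → ∃ c : ℂ, c ^ m₀ = 1 ∧ T g = c • LinearMap.id) →
      ∃ (m' : ℕ) (ι : V →ₗ[ℂ] (Fin m' → ℂ)) (p : (Fin m' → ℂ) →ₗ[ℂ] V)
        (τ : G → Equiv.Perm (Fin m')),
        m' ≤ Module.finrank ℂ V * Bd ∧ p ∘ₗ ι = LinearMap.id ∧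
        ∀ g, LinearMap.funLeft ℂ ℂ (τ g) ∘ₗ ι = ι ∘ₗ T g ∧
          p ∘ₗ LinearMap.funLeft ℂ ℂ (τ g) = T g ∘ₗ p := by
    intro r
    induction r with
    | zero =>
      intro V _ _ _ T hr _ _
      haveI : Subsingleton V := Module.finrank_zero_iff.mp (Nat.le_zero.mp hr)
      refine ⟨0, 0, 0, fun _ => 1, le_rfl.trans (Nat.zero_le _), ?_, fun g => ⟨?_, ?_⟩⟩
      · exact LinearMap.ext fun v => Subsingleton.elim _ _
      · rw [LinearMap.comp_zero, LinearMap.zero_comp]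
      · rw [LinearMap.zero_comp, LinearMap.comp_zero]
    | succ r ih =>
      intro V _ _ _ T hr hM hsc
      by_cases hle : Module.finrank ℂ V ≤ r
      · exact ih V T hle hM hsc
      have hrk : Module.finrank ℂ V = r + 1 := by omega
      by_cases hirr : ∀ W : Submodule ℂ V, (∀ g, W ≤ W.comap (T g)) → W = ⊥ ∨ W = ⊤
      · -- irreducible: pass to matrices in a basis and use (D)
        set k : ℕ := Module.finrank ℂ V with hk
        let b : Module.Basis (Fin k) ℂ V := Module.finBasis ℂ V
        let ρV : G →* GL (Fin k) ℂ :=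
          (Units.map ((LinearMap.toMatrixAlgEquiv b :
            (V →ₗ[ℂ] V) ≃ₐ[ℂ] Matrix (Fin k) (Fin k) ℂ).toMonoidHom)).comp T.toHomUnits
        have hρV : ∀ g, (ρV g : Matrix (Fin k) (Fin k) ℂ) = LinearMap.toMatrix b b (T g) := fun g => rfl
        -- `b.equivFun ∘ T g = ρV g ∘ b.equivFun`
        have hconj : ∀ g, (b.equivFun : V ≃ₗ[ℂ] (Fin k → ℂ)).toLinearMap ∘ₗ T g =
            Matrix.toLin' (ρV g : Matrix (Fin k) (Fin k) ℂ) ∘ₗ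
              (b.equivFun : V ≃ₗ[ℂ] (Fin k → ℂ)).toLinearMap := by
          intro g
          refine LinearMap.ext fun v => ?_
          simp only [LinearMap.coe_comp, LinearEquiv.coe_coe, Function.comp_apply, hρV,
            Matrix.toLin'_apply, Module.Basis.equivFun_apply, LinearMap.toMatrix_mulVec_repr]
        have hconj' : ∀ g, (b.equivFun.symm : (Fin k → ℂ) ≃ₗ[ℂ] V).toLinearMap ∘ₗ
            Matrix.toLin' (ρV g : Matrix (Fin k) (Fin k) ℂ) =
              T g ∘ₗ (b.equivFun.symm : (Fin k → ℂ) ≃ₗ[ℂ] V).toLinearMap := by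
          intro g
          refine LinearMap.ext fun w => ?_
          have := LinearMap.congr_fun (hconj g) (b.equivFun.symm w)
          simp only [LinearMap.coe_comp, LinearEquiv.coe_coe, Function.comp_apply,
            LinearEquiv.apply_symm_apply] at this
          simp only [LinearMap.coe_comp, LinearEquiv.coe_coe, Function.comp_apply]
          rw [← this, LinearEquiv.symm_apply_apply]
        -- irreducibility in coordinates
        have hirr' : ∀ W : Submodule ℂ (Fin k → ℂ),
            (∀ g : G, W ≤ W.comap (Matrix.toLin' (ρV g : Matrix (Fin k) (Fin k) ℂ))) →
              W = ⊥ ∨ W = ⊤ := by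
          intro W hW
          have hWc : ∀ g, W.comap (b.equivFun : V ≃ₗ[ℂ] (Fin k → ℂ)).toLinearMap ≤
              (W.comap (b.equivFun : V ≃ₗ[ℂ] (Fin k → ℂ)).toLinearMap).comap (T g) := by
            intro g v hv
            rw [Submodule.mem_comap] at hv ⊢
            rw [Submodule.mem_comap]
            have h2 := LinearMap.congr_fun (hconj g) v
            simp only [LinearMap.coe_comp, LinearEquiv.coe_coe, Function.comp_apply] at h2
            rw [LinearEquiv.coe_coe, h2]
            exact hW g hv
          have hmap : (W.comap (b.equivFun : V ≃ₗ[ℂ] (Fin k → ℂ)).toLinearMap).map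
              (b.equivFun : V ≃ₗ[ℂ] (Fin k → ℂ)).toLinearMap = W :=
            Submodule.map_comap_eq_of_surjective b.equivFun.surjective W
          rcases hirr _ hWc with h | h
          · left; rw [← hmap, h, Submodule.map_bot]
          · right; rw [← hmap, h, Submodule.map_top, LinearEquiv.range]
        have hkerV : ∀ g, φ g = 1 → ∃ c : ℂ, c ^ m₀ = 1 ∧
            (ρV g : Matrix (Fin k) (Fin k) ℂ) = c • (1 : Matrix (Fin k) (Fin k) ℂ) := by
          intro g hg
          obtain ⟨c, hc, hTg⟩ := hsc g hg
          refine ⟨c, hc, ?_⟩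
          rw [hρV, hTg, map_smul, LinearMap.toMatrix_id]
        obtain ⟨m', hm', ιM, pM, τ, hpι, hrel⟩ := hd n m₀ k G φ ρV hφ hkerV (hk ▸ hM) hirr'
        -- matrix retract → linear retract on coordinates
        have hpιL : Matrix.toLin' pM ∘ₗ Matrix.toLin' ιM = LinearMap.id := by
          rw [← Matrix.toLin'_mul, hpι, Matrix.toLin'_one]
        have hrelL : ∀ g, LinearMap.funLeft ℂ ℂ (τ g) ∘ₗ Matrix.toLin' ιM =
            Matrix.toLin' ιM ∘ₗ Matrix.toLin' (ρV g : Matrix (Fin k) (Fin k) ℂ) ∧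
            Matrix.toLin' pM ∘ₗ LinearMap.funLeft ℂ ℂ (τ g) =
              Matrix.toLin' (ρV g : Matrix (Fin k) (Fin k) ℂ) ∘ₗ Matrix.toLin' pM := by
          intro g
          rw [← toLin'_permMatrix, ← Matrix.toLin'_mul, ← Matrix.toLin'_mul, ← Matrix.toLin'_mul,
            ← Matrix.toLin'_mul, (hrel g).1, (hrel g).2]
          exact ⟨rfl, rfl⟩
        -- transport to `V`
        obtain ⟨h1, h2⟩ := linRetract_of_equiv (fun g => Matrix.toLin' (ρV g : Matrix (Fin k) (Fin k) ℂ))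
          (fun g => T g) b.equivFun.symm hconj' (Matrix.toLin' ιM) (Matrix.toLin' pM) τ hpιL hrelL
        refine ⟨m', _, _, τ, ?_, h1, h2⟩
        have hk1 : 1 ≤ k := by omega
        calc m' ≤ Bd := hm'
          _ = 1 * Bd := (one_mul _).symm
          _ ≤ k * Bd := Nat.mul_le_mul_right _ hk1
      · -- reducible: split along a Maschke complement
        push Not at hirr
        obtain ⟨W, hWinv, hWbot, hWtop⟩ := hirr
        obtain ⟨W', hcW, hW'inv⟩ := exists_invariant_compl T hWinv
        -- the restricted homomorphisms
        let TW : G →* (W →ₗ[ℂ] W) :=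
          { toFun := fun g => (T g).restrict (hWinv g)
            map_one' := by
              refine LinearMap.ext fun w => Subtype.ext ?_
              simp [LinearMap.coe_restrict_apply]
            map_mul' := fun a c => by
              refine LinearMap.ext fun w => Subtype.ext ?_
              simp [LinearMap.coe_restrict_apply, Module.End.mul_apply] }
        let TW' : G →* (W' →ₗ[ℂ] W') :=
          { toFun := fun g => (T g).restrict (hW'inv g)
            map_one' := by
              refine LinearMap.ext fun w => Subtype.ext ?_
              simp [LinearMap.coe_restrict_apply]
            map_mul' := fun a c => by
              refine LinearMap.ext fun w => Subtype.ext ?_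
              simp [LinearMap.coe_restrict_apply, Module.End.mul_apply] }
        have hTW : ∀ g, TW g = (T g).restrict (hWinv g) := fun g => rfl
        have hTW' : ∀ g, TW' g = (T g).restrict (hW'inv g) := fun g => rfl
        -- dimensions
        have hsum : Module.finrank ℂ W + Module.finrank ℂ W' = Module.finrank ℂ V := by
          have := Submodule.finrank_sup_add_finrank_inf_eq W W'
          rw [hcW.sup_eq_top, hcW.inf_eq_bot, finrank_top, finrank_bot, add_zero] at this
          exact this.symm
        have hdW : Module.finrank ℂ W < Module.finrank ℂ V :=
          Submodule.finrank_lt hWtop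
        have hW'top : W' ≠ ⊤ := by
          intro h
          apply hWbot
          have := hcW.inf_eq_bot
          rwa [h, inf_top_eq] at this
        have hdW' : Module.finrank ℂ W' < Module.finrank ℂ V :=
          Submodule.finrank_lt hW'top
        -- scalars on the kernel restrict
        have hscW : ∀ g, φ g = 1 → ∃ c : ℂ, c ^ m₀ = 1 ∧ TW g = c • LinearMap.id := by
          intro g hg
          obtain ⟨c, hc, hTg⟩ := hsc g hg
          refine ⟨c, hc, LinearMap.ext fun w => Subtype.ext ?_⟩
          simp [hTW, LinearMap.coe_restrict_apply, hTg]
        have hscW' : ∀ g, φ g = 1 → ∃ c : ℂ, c ^ m₀ = 1 ∧ TW' g = c • LinearMap.id := by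
          intro g hg
          obtain ⟨c, hc, hTg⟩ := hsc g hg
          refine ⟨c, hc, LinearMap.ext fun w => Subtype.ext ?_⟩
          simp [hTW', LinearMap.coe_restrict_apply, hTg]
        obtain ⟨a, ι₁, p₁, τ₁, ha, hpι₁, hr₁⟩ := ih W TW (by omega) (by omega) hscW
        obtain ⟨a', ι₂, p₂, τ₂, ha', hpι₂, hr₂⟩ := ih W' TW' (by omega) (by omega) hscW'
        obtain ⟨ι, p, τ, hpι, hr⟩ := linRetract_sum (fun g => T g) hcW hWinv hW'inv
          ι₁ p₁ τ₁ hpι₁ (fun g => hr₁ g) ι₂ p₂ τ₂ hpι₂ (fun g => hr₂ g)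
        obtain ⟨ι', p', τ', hpι', hr'⟩ := linRetract_reindex finSumFinEquiv (fun g => T g) ι p τ hpι hr
        refine ⟨a + a', ι', p', τ', ?_, hpι', hr'⟩
        calc a + a' ≤ Module.finrank ℂ W * Bd + Module.finrank ℂ W' * Bd := add_le_add ha ha'
          _ = Module.finrank ℂ V * Bd := by rw [← add_mul, hsum]
  -- apply to `ℂ^{m₀}` with `T g = ρ g`
  let T : G →* ((Fin m₀ → ℂ) →ₗ[ℂ] (Fin m₀ → ℂ)) :=
    { toFun := fun g => Matrix.toLin' (ρ g : Matrix (Fin m₀) (Fin m₀) ℂ)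
      map_one' := by simp only [map_one, Units.val_one, Matrix.toLin'_one]; rfl
      map_mul' := fun a c => by
        simp only [map_mul, Units.val_mul, Matrix.toLin'_mul]; rfl }
  have hT : ∀ g, T g = Matrix.toLin' (ρ g : Matrix (Fin m₀) (Fin m₀) ℂ) := fun g => rfl
  have hscT : ∀ g, φ g = 1 → ∃ c : ℂ, c ^ m₀ = 1 ∧ T g = c • LinearMap.id := by
    intro g hg
    obtain ⟨c, hc, hρg⟩ := hkerM g hg
    refine ⟨c, hc, ?_⟩
    rw [hT, hρg, map_smul, Matrix.toLin'_one]
  obtain ⟨m', ι, p, τ, hm', hpι, hr⟩ :=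
    key m₀ (Fin m₀ → ℂ) T (by rw [Module.finrank_fin_fun]) (by rw [Module.finrank_fin_fun]) hscT
  rw [Module.finrank_fin_fun] at hm'
  refine ⟨m', hm'.trans (mul_budget_le m₀ (Nat.log 2 m₀) (Nat.log 2 n) d
    (Nat.lt_pow_succ_log_self one_lt_two m₀)), LinearMap.toMatrix' ι, LinearMap.toMatrix' p, τ, ?_,
    fun g => ⟨?_, ?_⟩⟩
  · rw [← LinearMap.toMatrix'_comp, hpι, LinearMap.toMatrix'_id]
  · have hperm : (τ g).permMatrix ℂ = LinearMap.toMatrix' (LinearMap.funLeft ℂ ℂ (τ g)) := by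
      rw [← toLin'_permMatrix, LinearMap.toMatrix'_toLin']
    rw [hperm, ← LinearMap.toMatrix'_comp, (hr g).1, LinearMap.toMatrix'_comp, hT,
      LinearMap.toMatrix'_toLin']
  · have hperm : (τ g).permMatrix ℂ = LinearMap.toMatrix' (LinearMap.funLeft ℂ ℂ (τ g)) := by
      rw [← toLin'_permMatrix, LinearMap.toMatrix'_toLin']
    rw [hperm, ← LinearMap.toMatrix'_comp, (hr g).2, LinearMap.toMatrix'_comp, hT,
      LinearMap.toMatrix'_toLin']

/-- **(iii′) `PermEmbeddingQP` from the irreducible case (D)** — the composition of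
`permEmbedding_of_irreducible` with `permEmbeddingQP_of_abstract`; its conclusion is hypothesis
`h₃` of `permify_of_finiteLift_of_permEmbedding` / `permify_of_permEmbedding` verbatim. [folklore] -/
theorem permEmbeddingQP_of_irreducible
    (hD : ∃ d : ℕ, ∀ (n M k : ℕ) (G : Type) [Group G] [Finite G]
      (φ : G →* Equiv.Perm (Fin n) × Equiv.Perm (Fin n)) (ρ : G →* GL (Fin k) ℂ),
      Function.Surjective φ →
      (∀ g : G, φ g = 1 → ∃ c : ℂ, c ^ M = 1 ∧
        (ρ g : Matrix (Fin k) (Fin k) ℂ) = c • (1 : Matrix (Fin k) (Fin k) ℂ)) →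
      k ≤ M →
      (∀ W : Submodule ℂ (Fin k → ℂ),
        (∀ g : G, W ≤ W.comap (Matrix.toLin' (ρ g : Matrix (Fin k) (Fin k) ℂ))) → W = ⊥ ∨ W = ⊤) →
      ∃ m' ≤ 2 ^ ((Nat.log 2 M + Nat.log 2 n + d) ^ d),
        ∃ (ι : Matrix (Fin m') (Fin k) ℂ) (p : Matrix (Fin k) (Fin m') ℂ) (τ : G → Equiv.Perm (Fin m')),
          p * ι = 1 ∧ ∀ g : G,
            (τ g).permMatrix ℂ * ι = ι * (ρ g : Matrix (Fin k) (Fin k) ℂ) ∧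
            p * (τ g).permMatrix ℂ = (ρ g : Matrix (Fin k) (Fin k) ℂ) * p) :
    ∃ d : ℕ, ∀ (n m₀ : ℕ)
      (F : Subgroup ((Equiv.Perm (Fin n) × Equiv.Perm (Fin n)) × GL (Fin m₀) ℂ)),
      (∀ π ρ : Equiv.Perm (Fin n), ∃ g : GL (Fin m₀) ℂ, ((π, ρ), g) ∈ F) →
      (∀ g : GL (Fin m₀) ℂ, ((1 : Equiv.Perm (Fin n) × Equiv.Perm (Fin n)), g) ∈ F →
        ∃ c : ℂ, (g : Matrix (Fin m₀) (Fin m₀) ℂ) = c • (1 : Matrix (Fin m₀) (Fin m₀) ℂ)) →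
      (∀ x ∈ F, Matrix.det (x.2 : Matrix (Fin m₀) (Fin m₀) ℂ) = 1) →
      ∃ m' ≤ 2 ^ ((Nat.log 2 m₀ + Nat.log 2 n + d) ^ d),
        ∃ (ι : Matrix (Fin m') (Fin m₀) ℂ) (p : Matrix (Fin m₀) (Fin m') ℂ)
          (τ : (Equiv.Perm (Fin n) × Equiv.Perm (Fin n)) × GL (Fin m₀) ℂ → Equiv.Perm (Fin m')),
          p * ι = 1 ∧ ∀ x ∈ F,
            (τ x).permMatrix ℂ * ι = ι * (x.2 : Matrix (Fin m₀) (Fin m₀) ℂ) ∧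
            p * (τ x).permMatrix ℂ = (x.2 : Matrix (Fin m₀) (Fin m₀) ℂ) * p :=
  permEmbeddingQP_of_abstract (permEmbedding_of_irreducible hD)

end Summit.ValiantsHypothesis.ValiantsHypothesis.Theorems.SymPencilEquivariantSdcNotQP

end
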